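import Mathlib

/-!
# Clause 13-J, brick B7-avg (companion): the REAL 2×2 ↔ COMPLEX dictionary for the far-branch normal form

Route `FilamentSkeletonRss`, child 28296 `Clause13NearStraight` (and its A1L twin); companion to
`…Clause13TransportAveraging` (J-averaging normal form in complex notation) and `…Clause13TraceIdentity` ((I1): normal-block
trace `3/2 − w′`).  The frozen far-branch system on the normal plane is `w·Y′ = (G·J + B)Y + F` with a real 2×2 local gradient
`B = [[p, q], [r, s]]`; identifying the plane with `ℂ` (`J = i`) it reads `w·z′ = iG z + α z + β z̄ + f` with
`α = ((p+s) + i(r−q))/2`, `β = ((p−s) + i(r+q))/2` (`realLinear_eq_complexForm`).  Hence the J-AVERAGED RATE of the averaging file is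
`Re α = ½ tr B` (`complexForm_re_alpha`) — by (I1) this is `β̄ = ¾ − w′/2` for the tangency problem — and the averaged-away
anisotropy is `|β|`, with `4|β|² = (p−s)² + (r+q)²`; for symmetric `B` this is the discriminant `tr² − 4 det = (λ₁ − λ₂)²`
(`complexForm_normSq_beta`, `four_normSq_beta_eq_discr`), i.e. `|β| = ½|λ₁ − λ₂| = d` of the tenure note §3 (I1).
Lane ns-filament-19175-p1 g13; `--supports stmt-NavierStokesRegularity-28296 --as helper`.
HONEST FRAMING: linear algebra for the bookkeeping of a HYPOTHETICAL filament skeleton on the NEGATIVE side of a MODEL route;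
nothing here bears on Navier–Stokes regularity or blow-up.
-/

noncomputable section

open scoped ComplexConjugate
open Complex

namespace Summit.NavierStokesRegularity.NavierStokesRegularity.Theorems.Clause13Transport
set_option linter.dupNamespace false

/-- **Real 2×2 ↔ complex form.**  A real-linear map of the plane with matrix `[[p, q], [r, s]]` (acting on `(x, y) ↦ (px + qy, rx + sy)`)
is, on `z = x + iy`, the map `z ↦ α z + β z̄` with `α = ((p + s) + i(r − q))/2`, `β = ((p − s) + i(r + q))/2`.  In particular
`Re α = ½ tr` (the J-averaged rate of `…Clause13TraceIdentity`/(I1)), `Im α = ½ (r − q)` (the rotation part), and for a symmetric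
matrix (`q = r`) `|β| = ½|λ₁ − λ₂|` is the anisotropy `d` of the tenure note. [folklore] -/
theorem realLinear_eq_complexForm (p q r s x y : ℝ) :
    (((p * x + q * y : ℝ) : ℂ) + ((r * x + s * y : ℝ) : ℂ) * I)
      = (((p + s : ℝ) : ℂ) + ((r - q : ℝ) : ℂ) * I) / 2 * ((x : ℂ) + (y : ℂ) * I)
        + (((p - s : ℝ) : ℂ) + ((r + q : ℝ) : ℂ) * I) / 2 * conj ((x : ℂ) + (y : ℂ) * I) := by
  have hconj : conj ((x : ℂ) + (y : ℂ) * I) = (x : ℂ) - (y : ℂ) * I := by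
    simp [map_add, map_mul, Complex.conj_ofReal, Complex.conj_I]; ring
  rw [hconj]
  push_cast
  linear_combination ((q : ℂ) * y) * Complex.I_sq

/-- The real part of the complex-linear coefficient is half the trace. [folklore] -/
theorem complexForm_re_alpha (p q r s : ℝ) :
    ((((p + s : ℝ) : ℂ) + ((r - q : ℝ) : ℂ) * I) / 2).re = (p + s) / 2 := by
  simp [Complex.add_re, Complex.div_ofNat_re]

/-- For a symmetric matrix (`q = r`) the anti-linear coefficient has modulus `½√((p − s)² + 4q²) = ½|λ₁ − λ₂|`:
`‖β‖² = ((p − s)² + (2q)²)/4`. [folklore] -/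
theorem complexForm_normSq_beta (p q s : ℝ) :
    ‖(((p - s : ℝ) : ℂ) + ((q + q : ℝ) : ℂ) * I) / 2‖ ^ 2 = ((p - s) ^ 2 + (2 * q) ^ 2) / 4 := by
  rw [norm_div, div_pow, Complex.norm_two, ← Complex.normSq_eq_norm_sq, Complex.normSq_add_mul_I]
  ring

/-- Symmetric case: `4‖β‖² = tr² − 4·det = (λ₁ − λ₂)²` (the discriminant of `[[p, q], [q, s]]`). [folklore] -/
theorem four_normSq_beta_eq_discr (p q s : ℝ) :
    4 * ‖(((p - s : ℝ) : ℂ) + ((q + q : ℝ) : ℂ) * I) / 2‖ ^ 2 = (p + s) ^ 2 - 4 * (p * s - q * q) := by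
  rw [complexForm_normSq_beta]; ring

end Summit.NavierStokesRegularity.NavierStokesRegularity.Theorems.Clause13Transport
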